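import Summits.Ventures.PercRepro.CodeProfile
import Summits.Ventures.PercRepro.CodeTypes
import Summits.Ventures.PercRepro.SignRank
import Summits.Ventures.PercRepro.CodeBoundEight

/-!
# PercRepro — CodeBound8 assembled from its pieces (typer-2, gen 5)

p4's hand proof of the 8-point code bound (`proofs/P4-seven.md` §9.1) in the kernel, modulo its two
graph-theoretic inputs: for a code `C` on `Fin 8` with colouring `cl` (p4's `CodeBound8Fin` hypotheses),

* the three unordered bipartition types `X = typeRep C cl 0 1`, `Y = typeRep C cl 0 2`, `Z = typeRep C cl 1 2`
  are nonempty (the axiom «all colour pairs occur») and partition `C` up to complement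
  (`card_eq_two_mul_types`: `|C| = 2·(|X| + |Y| + |Z|)`);
* cross-type meets are `2` and same-type meets are `2` or `3` (`CodeTypes.lean`), so the sign-vector spans are
  mutually orthogonal in `𝟙^⊥` with `finrank U_X + finrank U_Y + finrank U_Z ≤ 7` (piece (D), `SignVec.lean`);
* **(H)**, supplied as a hypothesis `hH`: every family `X` of 4-sets whose distinct members meet in `2` or `3`
  points has `hrank |X| ≤ finrank (span (signVec '' X))` (p4: `finrank = rank(2I + A)` by `SignRank.lean`, and
  `rank(2I + A) ≥ h(|X|)` by `RankFive.lean` + principal submatrices);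
* **(K)**, supplied as a hypothesis `hK`: every type has at most `6` members (p4: `KleitmanQ4.lean` + the
  quadrant lemma);
* the profile arithmetic (`CodeProfile.lean`) then gives `|C| ≤ 18`.

**`codeBound8Fin_of_rank_of_kleitman`**: `(H) → (K) → CodeBound8Fin`.
-/

namespace PercRepro

open Module Submodule Finset

/-- Every type is nonempty under the axiom «all colour pairs occur». -/
theorem one_le_card_typeRep (C : Finset (Finset (Fin 8))) (cl : Finset (Fin 8) → Fin 3)
    (hocc : ∀ i j : Fin 3, i ≠ j → ∃ σ ∈ C, cl σ = i ∧ cl σᶜ = j) {i j : Fin 3} (hij : i ≠ j) :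
    1 ≤ (typeRep C cl i j).card := by
  obtain ⟨σ, hσ, hi, hj⟩ := hocc i j hij
  exact Finset.card_pos.mpr ⟨σ, mem_typeRep.mpr ⟨hσ, hi, hj⟩⟩

/-- Members of a type are 4-sets. -/
theorem card_eq_four_of_mem_typeRep {C : Finset (Finset (Fin 8))} {cl : Finset (Fin 8) → Fin 3}
    (h4 : ∀ σ ∈ C, σ.card = 4) {i j : Fin 3} {σ : Finset (Fin 8)} (hσ : σ ∈ typeRep C cl i j) :
    σ.card = 4 :=
  h4 σ (mem_typeRep.mp hσ).1

/-- **CodeBound8 on `Fin 8` from the two graph-theoretic inputs**: if every «same-type» family of 4-sets has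
sign-vector span of dimension `≥ hrank (its size)` (piece (H)) and every type has `≤ 6` members (piece (K)),
then every code has at most `18` members. -/
theorem codeBound8Fin_of_rank_of_kleitman
    (hH : ∀ X : Finset (Finset (Fin 8)), (∀ σ ∈ X, σ.card = 4) →
      (∀ σ ∈ X, ∀ τ ∈ X, σ ≠ τ → (σ ∩ τ).card = 2 ∨ (σ ∩ τ).card = 3) →
        hrank X.card ≤ finrank ℝ (span ℝ (signVec '' (X : Set (Finset (Fin 8))))))
    (hK : ∀ (C : Finset (Finset (Fin 8))) (cl : Finset (Fin 8) → Fin 3),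
      (∀ σ ∈ C, σ.card = 4) → (∀ σ ∈ C, σᶜ ∈ C) → (∀ σ ∈ C, cl σᶜ ≠ cl σ) →
      (∀ σ ∈ C, ∀ τ ∈ C, cl σ ≠ cl τ → (σ ∩ τ).card ≤ 2) →
      (∀ i j : Fin 3, i ≠ j → ∃ σ ∈ C, cl σ = i ∧ cl σᶜ = j) →
        ∀ i j : Fin 3, i ≠ j → (typeRep C cl i j).card ≤ 6) :
    CodeBound8Fin := by
  intro C cl h4 hcompl hcl hne hocc
  -- the three unordered types
  have hX4 : ∀ σ ∈ typeRep C cl 0 1, σ.card = 4 := fun σ hσ => card_eq_four_of_mem_typeRep h4 hσ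
  have hY4 : ∀ σ ∈ typeRep C cl 0 2, σ.card = 4 := fun σ hσ => card_eq_four_of_mem_typeRep h4 hσ
  have hZ4 : ∀ σ ∈ typeRep C cl 1 2, σ.card = 4 := fun σ hσ => card_eq_four_of_mem_typeRep h4 hσ
  -- same-type meets
  have hXX : ∀ σ ∈ typeRep C cl 0 1, ∀ τ ∈ typeRep C cl 0 1, σ ≠ τ → (σ ∩ τ).card = 2 ∨ (σ ∩ τ).card = 3 :=
    fun σ hσ τ hτ hst => card_inter_mem_of_type_eq C cl h4 hcompl hcl hne hσ hτ hst
  have hYY : ∀ σ ∈ typeRep C cl 0 2, ∀ τ ∈ typeRep C cl 0 2, σ ≠ τ → (σ ∩ τ).card = 2 ∨ (σ ∩ τ).card = 3 :=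
    fun σ hσ τ hτ hst => card_inter_mem_of_type_eq C cl h4 hcompl hcl hne hσ hτ hst
  have hZZ : ∀ σ ∈ typeRep C cl 1 2, ∀ τ ∈ typeRep C cl 1 2, σ ≠ τ → (σ ∩ τ).card = 2 ∨ (σ ∩ τ).card = 3 :=
    fun σ hσ τ hτ hst => card_inter_mem_of_type_eq C cl h4 hcompl hcl hne hσ hτ hst
  -- cross-type meets
  have hXY : ∀ σ ∈ typeRep C cl 0 1, ∀ τ ∈ typeRep C cl 0 2, (σ ∩ τ).card = 2 :=
    fun σ hσ τ hτ => card_inter_eq_two_of_types_ne C cl h4 hcompl hcl hne (by decide) hσ hτ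
  have hXZ : ∀ σ ∈ typeRep C cl 0 1, ∀ τ ∈ typeRep C cl 1 2, (σ ∩ τ).card = 2 :=
    fun σ hσ τ hτ => card_inter_eq_two_of_types_ne C cl h4 hcompl hcl hne (by decide) hσ hτ
  have hYZ : ∀ σ ∈ typeRep C cl 0 2, ∀ τ ∈ typeRep C cl 1 2, (σ ∩ τ).card = 2 :=
    fun σ hσ τ hτ => card_inter_eq_two_of_types_ne C cl h4 hcompl hcl hne (by decide) hσ hτ
  -- piece (D)
  have hD := finrank_span_signVec_add_three_le_seven _ _ _ hX4 hY4 hZ4 hXY hXZ hYZ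
  -- piece (H)
  have hHX := hH _ hX4 hXX
  have hHY := hH _ hY4 hYY
  have hHZ := hH _ hZ4 hZZ
  -- piece (K) and nonemptiness
  have hKX := hK C cl h4 hcompl hcl hne hocc 0 1 (by decide)
  have hKY := hK C cl h4 hcompl hcl hne hocc 0 2 (by decide)
  have hKZ := hK C cl h4 hcompl hcl hne hocc 1 2 (by decide)
  have h1X := one_le_card_typeRep C cl hocc (i := 0) (j := 1) (by decide)
  have h1Y := one_le_card_typeRep C cl hocc (i := 0) (j := 2) (by decide)
  have h1Z := one_le_card_typeRep C cl hocc (i := 1) (j := 2) (by decide)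
  -- the profile arithmetic
  exact code_card_le_of_profile (card_eq_two_mul_types C cl hcompl hcl) h1X h1Y h1Z hKX hKY hKZ hHX hHY hHZ hD

end PercRepro
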